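import Summits.QuantumFields.YangMills.Theorems.BalabanUVNodesN07HessOpTraceSU2
import Literature.MathematicalPhysics.QuantumFieldTheory.Balaban1983to89.Node00.BgGaugeLetterOfRecord
import HarnessLib

/-!
# NODE N07 — THE STRUCTURAL LETTERS OF def-Y's SCHEME RESPECT THE TRACE SECTORS AT EVERY `N`: the transporters `R(U₀(b))`, `R(U₀(b)⁻¹)`, the covariant derivative `D_{U₀}`, the
# divergence `D*_{U₀}`, the site Laplacian `Δ_{U₀} = D*D` and the flat gauge letter `Q′♭` of record map TRACELESS-valued fields to traceless-valued ones and SCALAR-valued fields to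
# scalar-valued ones ([B9] (3.2)–(3.3) pp. 390–391, (3.8)–(3.9), (3.23) pp. 392–394; [15] (51) p. 286 «for A′ with values in 𝔤 … D(A′) has values in 𝔤 also»)

Cell `pub-ymgap`, width seat `pub-ymgap-dag-n07-w3` (g26), CLAIM-16.  `--kind proof --supports stmt-QuantumFields-27238 --as helper`; count-neutral.  The trace companion of ✓p821508
`…N07RecordLettersReality` §2–§3 (which did the `⋆`-half), for the TRACE half of def-Y's rows (`TY := evHerm0` keeps the trace; `N = 2` is where `Δ′`, `J` need it — ✓`…N07CurvFormTraceSU2`,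
✓`…N07HessOpTraceSU2` — but the letters here respect the sectors at every `N`).
[15] = [Balaban1985Variational]; [B9] = [Balaban1985BackgroundPropagators].

CONTENTS (`φ = phiRec N`; «traceless-valued» := `∀ x, tr φ(f x) = 0`; «scalar-valued» := `∀ x, ∃ r, φ(f x) = r·1`).
* §1 (any module, any submodule `M` of the fibre) `covDeriv_mem`, `covDiv_mem` — `M`-valued in ⟹ `M`-valued out when the transporters preserve `M`.
* §2 (record fibre, every `N`) the two sectors as submodules of the Hilbert fibre `WRec N`: `mem_kerTracePhi_iff`, `mem_spanPhiSymmOne_iff`; `adTransportW_mem_kerTracePhi`, `adTransportW_mem_spanPhiSymmOne`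
  (✓`…N07HessOpTraceSU2.trace_phiRec_adTransportW` ∕ `adTransportW_smul_one`), hence for `RRec`, `SRec`.
* §3 ★`covDerivL2K_ofRecord_traceless`∕`_scalar`, ★`covDivL2K_ofRecord_traceless`∕`_scalar`, ★`covLaplaceSiteK_ofRecord_traceless`∕`_scalar`, ★`QflatOfRecord_traceless`∕`_scalar`.

HONEST LABELS.  Linear bookkeeping; no estimate; the projection `R(U₀; Q′♭)`, the inverses `G₁`, `K⁻¹`, `H₁` and the averaging letter `Q(U₀)` are NOT here (next: finite-dimensional inverse argument and the
orthogonal-projection argument, which need BOTH sectors).  Count-neutral; N07 NOT discharged; P0 ⟨26900⟩ OPEN; R4 is the conditional finite-𝕋⁴ rung only.  Nothing here is a claim about the Yang–Mills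
mass gap (`Summit.QuantumFields`): finite torus, fixed `ε`; nothing continuum ∕ OS ∕ Clay.
-/

set_option autoImplicit false

noncomputable section

open scoped Matrix Matrix.Norms.L2Operator InnerProductSpace ComplexConjugate BigOperators

namespace Summit.QuantumFields.YangMills.Theorems.N07RecordLettersTraceSectors

open Literature.MathematicalPhysics.QuantumFieldTheory.Balaban1983to89
open Literature.MathematicalPhysics.QuantumFieldTheory.Balaban1983to89.T4Continuum (T4Family)
open T4Continuum BlockAveraging
open Node00
open B4Sect5Torus (TSite)
open B9SectCLatticeCarrier (Bond bpos btgt unshift)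
open B9Eq311L2Pairing (WL2)
open B9Eq33CovDerivVector (covDeriv covDeriv_apply covDiv covDiv_apply)
open B9Eq310HessianOperator (adTransportW adTransportW_apply)
open B11Eq103H1Complex (SiteL2K BondL2K covDerivL2K covDivL2K covLaplaceSiteK equiv_covDerivL2K equiv_covDivL2K)
open Summit.QuantumFields.YangMills.Theorems.N07HessOpTraceSU2 (trace_phiRec_adTransportW adTransportW_smul_one)

/-! ## §1  Submodule-valued fields under the covariant derivative and divergence -/

section Submodule

variable {𝕜 : Type*} [Field 𝕜] {V : Type*} [AddCommGroup V] [Module 𝕜 V] {d : ℕ} {Pd : Fin d → ℕ} (M : Submodule 𝕜 V)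

/-- **If every transporter preserves a submodule `M` of the fibre, `D_U` (3.3) maps `M`-valued site functions to `M`-valued bond functions.**
[cite: Balaban1985BackgroundPropagators, (3.3) p.391; Balaban1985Variational, (51) p.286] -/
theorem covDeriv_mem (c : 𝕜) {R : Bond d Pd → V →ₗ[𝕜] V} (hR : ∀ b v, v ∈ M → R b v ∈ M) {f : TSite d Pd → V} (hf : ∀ x, f x ∈ M) (b : Bond d Pd) :
    covDeriv c R f b ∈ M := by
  rw [covDeriv_apply]
  exact M.smul_mem _ (M.sub_mem (hR _ _ (hf _)) (hf _))

/-- **… and `D*_U` (3.8) maps `M`-valued bond functions to `M`-valued site functions.** [cite: Balaban1985BackgroundPropagators, (3.8) p.392] -/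
theorem covDiv_mem (c : 𝕜) {S : Bond d Pd → V →ₗ[𝕜] V} (hS : ∀ b v, v ∈ M → S b v ∈ M) {A : Bond d Pd → V} (hA : ∀ b, A b ∈ M) (y : TSite d Pd) :
    covDiv c S A y ∈ M := by
  rw [covDiv_apply]
  exact M.smul_mem _ (M.sum_mem fun μ _ => M.sub_mem (hS _ _ (hA _)) (hA _))

end Submodule

/-! ## §2  The two sectors of the record fibre as submodules; the transporters preserve them -/

section Fibre

variable (N : ℕ) {d : ℕ} {Pd : Fin d → ℕ} (V : Bond d Pd → (Matrix (Fin N) (Fin N) ℂ)ˣ)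

/-- Membership in the TRACELESS sector `ker(tr ∘ φ)` of the Hilbert fibre of record. [cite: Balaban1985Variational, (51) p.286 (the algebra `𝔤`)] -/
theorem mem_kerTracePhi_iff (w : WRec N) :
    w ∈ LinearMap.ker (Matrix.traceLinearMap (Fin N) ℂ ℂ ∘ₗ (phiRec N).toLinearMap) ↔ (phiRec N w).trace = 0 := by
  simp only [LinearMap.mem_ker, LinearMap.coe_comp, Function.comp_apply, LinearEquiv.coe_coe, Matrix.traceLinearMap_apply]

/-- Membership in the SCALAR sector `ℂ·φ⁻¹(1)` of the Hilbert fibre of record. [cite: Balaban1985BackgroundPropagators, p.391 («N × N hermitian matrices»)] -/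
theorem mem_spanPhiSymmOne_iff (w : WRec N) :
    w ∈ (ℂ ∙ (phiRec N).symm (1 : Matrix (Fin N) (Fin N) ℂ)) ↔ ∃ r : ℂ, phiRec N w = r • (1 : Matrix (Fin N) (Fin N) ℂ) := by
  rw [Submodule.mem_span_singleton]
  constructor
  · rintro ⟨r, hr⟩; exact ⟨r, by rw [← hr, map_smul, LinearEquiv.apply_symm_apply]⟩
  · rintro ⟨r, hr⟩; exact ⟨r, by rw [← map_smul, ← hr, LinearEquiv.symm_apply_apply]⟩

/-- **Transport preserves the traceless sector** (`tr(V X V⁻¹) = tr X`). [cite: Balaban1985BackgroundPropagators, (3.2) p.391] -/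
theorem adTransportW_mem_kerTracePhi (b : Bond d Pd) {w : WRec N} (hw : w ∈ LinearMap.ker (Matrix.traceLinearMap (Fin N) ℂ ℂ ∘ₗ (phiRec N).toLinearMap)) :
    adTransportW (phiRec N) V b w ∈ LinearMap.ker (Matrix.traceLinearMap (Fin N) ℂ ℂ ∘ₗ (phiRec N).toLinearMap) := by
  rw [mem_kerTracePhi_iff] at hw ⊢
  rw [trace_phiRec_adTransportW, hw]

/-- **Transport preserves the scalar sector** (`V (r·1) V⁻¹ = r·1`). [cite: Balaban1985BackgroundPropagators, p.390] -/
theorem adTransportW_mem_spanPhiSymmOne (b : Bond d Pd) {w : WRec N} (hw : w ∈ (ℂ ∙ (phiRec N).symm (1 : Matrix (Fin N) (Fin N) ℂ))) :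
    adTransportW (phiRec N) V b w ∈ (ℂ ∙ (phiRec N).symm (1 : Matrix (Fin N) (Fin N) ℂ)) := by
  obtain ⟨r, hr⟩ := (mem_spanPhiSymmOne_iff N w).1 hw
  have hw' : w = (phiRec N).symm (r • (1 : Matrix (Fin N) (Fin N) ℂ)) := by rw [← hr, LinearEquiv.symm_apply_apply]
  rw [hw', adTransportW_smul_one]
  exact (mem_spanPhiSymmOne_iff N _).2 ⟨r, LinearEquiv.apply_symm_apply _ _⟩

end Fibre

/-! ## §3  `D_{U₀}`, `D*_{U₀}`, `Δ_{U₀}` and `Q′♭` of record respect both sectors, every `N` -/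

section Record

variable (F : T4Family) (N : ℕ) (K : ℕ) (k : ℕ) (U₀ : GaugeField (F.P K) 0 (SU N)) [Fact (0 < c0Rec F K k)]

/-- ★ **`D_{U₀}` OF RECORD MAPS TRACELESS-VALUED SITE FIELDS TO TRACELESS-VALUED BOND FIELDS.** [cite: Balaban1985BackgroundPropagators, (3.3) p.391; Balaban1985Variational, (51) p.286] -/
theorem covDerivL2K_ofRecord_traceless {f : SiteL2K ℂ (F.P K).d (fun _ => (F.P K).sitesPerDir 0) (c0Rec F K k) (WRec N)}
    (hf : ∀ x, (phiRec N (WL2.equiv ℂ _ (WRec N) f x)).trace = 0) (b : Bond (F.P K).d (fun _ => (F.P K).sitesPerDir 0)) :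
    (phiRec N (WL2.equiv ℂ _ (WRec N) (covDerivL2K ℂ (c0Rec F K k) (cRec F K k) (RRec F N U₀) f) b)).trace = 0 := by
  rw [equiv_covDerivL2K, ← mem_kerTracePhi_iff]
  exact covDeriv_mem _ _ (fun b v hv => adTransportW_mem_kerTracePhi N (unitsOfRecord F N U₀) b hv) (fun x => (mem_kerTracePhi_iff N _).2 (hf x)) b

/-- ★ **`D_{U₀}` OF RECORD MAPS SCALAR-VALUED SITE FIELDS TO SCALAR-VALUED BOND FIELDS.** [cite: Balaban1985BackgroundPropagators, (3.3) p.391] -/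
theorem covDerivL2K_ofRecord_scalar {f : SiteL2K ℂ (F.P K).d (fun _ => (F.P K).sitesPerDir 0) (c0Rec F K k) (WRec N)}
    (hf : ∀ x, ∃ r : ℂ, phiRec N (WL2.equiv ℂ _ (WRec N) f x) = r • (1 : Matrix (Fin N) (Fin N) ℂ)) (b : Bond (F.P K).d (fun _ => (F.P K).sitesPerDir 0)) :
    ∃ r : ℂ, phiRec N (WL2.equiv ℂ _ (WRec N) (covDerivL2K ℂ (c0Rec F K k) (cRec F K k) (RRec F N U₀) f) b) = r • (1 : Matrix (Fin N) (Fin N) ℂ) := by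
  rw [equiv_covDerivL2K, ← mem_spanPhiSymmOne_iff]
  exact covDeriv_mem _ _ (fun b v hv => adTransportW_mem_spanPhiSymmOne N (unitsOfRecord F N U₀) b hv) (fun x => (mem_spanPhiSymmOne_iff N _).2 (hf x)) b

/-- ★ **`D*_{U₀}` OF RECORD MAPS TRACELESS-VALUED BOND FIELDS TO TRACELESS-VALUED SITE FIELDS.** [cite: Balaban1985BackgroundPropagators, (3.8) p.392; Balaban1985Variational, (51) p.286] -/
theorem covDivL2K_ofRecord_traceless {A : BondL2K ℂ (F.P K).d (fun _ => (F.P K).sitesPerDir 0) (c0Rec F K k) (WRec N)}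
    (hA : ∀ b, (phiRec N (WL2.equiv ℂ _ (WRec N) A b)).trace = 0) (x : TSite (F.P K).d (fun _ => (F.P K).sitesPerDir 0)) :
    (phiRec N (WL2.equiv ℂ _ (WRec N) (covDivL2K ℂ (c0Rec F K k) (cRec F K k) (SRec F N U₀) A) x)).trace = 0 := by
  rw [equiv_covDivL2K, ← mem_kerTracePhi_iff]
  exact covDiv_mem _ _ (fun b v hv => adTransportW_mem_kerTracePhi N (fun a => (unitsOfRecord F N U₀ a)⁻¹) b hv) (fun b => (mem_kerTracePhi_iff N _).2 (hA b)) x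

/-- ★ **`D*_{U₀}` OF RECORD MAPS SCALAR-VALUED BOND FIELDS TO SCALAR-VALUED SITE FIELDS.** [cite: Balaban1985BackgroundPropagators, (3.8) p.392] -/
theorem covDivL2K_ofRecord_scalar {A : BondL2K ℂ (F.P K).d (fun _ => (F.P K).sitesPerDir 0) (c0Rec F K k) (WRec N)}
    (hA : ∀ b, ∃ r : ℂ, phiRec N (WL2.equiv ℂ _ (WRec N) A b) = r • (1 : Matrix (Fin N) (Fin N) ℂ)) (x : TSite (F.P K).d (fun _ => (F.P K).sitesPerDir 0)) :
    ∃ r : ℂ, phiRec N (WL2.equiv ℂ _ (WRec N) (covDivL2K ℂ (c0Rec F K k) (cRec F K k) (SRec F N U₀) A) x) = r • (1 : Matrix (Fin N) (Fin N) ℂ) := by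
  rw [equiv_covDivL2K, ← mem_spanPhiSymmOne_iff]
  exact covDiv_mem _ _ (fun b v hv => adTransportW_mem_spanPhiSymmOne N (fun a => (unitsOfRecord F N U₀ a)⁻¹) b hv) (fun b => (mem_spanPhiSymmOne_iff N _).2 (hA b)) x

/-- ★ **`Δ_{U₀} = D*D` ON THE SITE FIELDS OF RECORD MAPS TRACELESS-VALUED TO TRACELESS-VALUED.** [cite: Balaban1985BackgroundPropagators, (3.23) p.394; Balaban1985Variational, (51) p.286] -/
theorem covLaplaceSiteK_ofRecord_traceless {f : SiteL2K ℂ (F.P K).d (fun _ => (F.P K).sitesPerDir 0) (c0Rec F K k) (WRec N)}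
    (hf : ∀ x, (phiRec N (WL2.equiv ℂ _ (WRec N) f x)).trace = 0) (x : TSite (F.P K).d (fun _ => (F.P K).sitesPerDir 0)) :
    (phiRec N (WL2.equiv ℂ _ (WRec N) (covLaplaceSiteK (cRec F K k) (RRec F N U₀) (SRec F N U₀) f) x)).trace = 0 := by
  rw [covLaplaceSiteK, LinearMap.comp_apply]
  exact covDivL2K_ofRecord_traceless F N K k U₀ (covDerivL2K_ofRecord_traceless F N K k U₀ hf) x

/-- ★ **`Δ_{U₀} = D*D` ON THE SITE FIELDS OF RECORD MAPS SCALAR-VALUED TO SCALAR-VALUED.** [cite: Balaban1985BackgroundPropagators, (3.23) p.394] -/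
theorem covLaplaceSiteK_ofRecord_scalar {f : SiteL2K ℂ (F.P K).d (fun _ => (F.P K).sitesPerDir 0) (c0Rec F K k) (WRec N)}
    (hf : ∀ x, ∃ r : ℂ, phiRec N (WL2.equiv ℂ _ (WRec N) f x) = r • (1 : Matrix (Fin N) (Fin N) ℂ)) (x : TSite (F.P K).d (fun _ => (F.P K).sitesPerDir 0)) :
    ∃ r : ℂ, phiRec N (WL2.equiv ℂ _ (WRec N) (covLaplaceSiteK (cRec F K k) (RRec F N U₀) (SRec F N U₀) f) x) = r • (1 : Matrix (Fin N) (Fin N) ℂ) := by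
  rw [covLaplaceSiteK, LinearMap.comp_apply]
  exact covDivL2K_ofRecord_scalar F N K k U₀ (covDerivL2K_ofRecord_scalar F N K k U₀ hf) x

omit [Fact (0 < c0Rec F K k)] in
/-- ★ **`Q′♭` OF RECORD MAPS TRACELESS-VALUED SITE FIELDS TO TRACELESS `k`-FIELDS** (restriction to the centres sees only the values). [cite: Balaban1985Averaging, (11) p.19; Balaban1985BackgroundPropagators, (3.19) p.393] -/
theorem QflatOfRecord_traceless {f : SiteL2K ℂ (F.P K).d (fun _ => (F.P K).sitesPerDir 0) (c0Rec F K k) (WRec N)}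
    (hf : ∀ x, (phiRec N (WL2.equiv ℂ _ (WRec N) f x)).trace = 0) (y : Site (F.P K) k) : (QflatOfRecord F N k f y).trace = 0 := by
  rw [QflatOfRecord_apply, siteFieldIn_apply]
  exact hf _

omit [Fact (0 < c0Rec F K k)] in
/-- ★ **`Q′♭` OF RECORD MAPS SCALAR-VALUED SITE FIELDS TO SCALAR `k`-FIELDS.** [cite: Balaban1985Averaging, (11) p.19; Balaban1985BackgroundPropagators, (3.19) p.393] -/
theorem QflatOfRecord_scalar {f : SiteL2K ℂ (F.P K).d (fun _ => (F.P K).sitesPerDir 0) (c0Rec F K k) (WRec N)}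
    (hf : ∀ x, ∃ r : ℂ, phiRec N (WL2.equiv ℂ _ (WRec N) f x) = r • (1 : Matrix (Fin N) (Fin N) ℂ)) (y : Site (F.P K) k) :
    ∃ r : ℂ, QflatOfRecord F N k f y = r • (1 : Matrix (Fin N) (Fin N) ℂ) := by
  rw [QflatOfRecord_apply, siteFieldIn_apply]
  exact hf _

end Record

end Summit.QuantumFields.YangMills.Theorems.N07RecordLettersTraceSectors

end
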